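import Literature.IUT.HodgeArakelov.AbsTopMonoidsGenuineProducer
import Literature.IUT.HodgeArakelov.AbsTopMonoidsNonVacuityAug
import Literature.IUT.HodgeArakelov.MonoThetaCyclotomesBridgeEtTh
import Literature.AnabelianGeometry.SemiGraphs.TemperedCurveGalois
import Literature.AnabelianGeometry.AbsoluteAnabelian.MonoAnalyticLogShellsSubProofs
import Literature.AnabelianGeometry.AbsoluteAnabelian.MLFGaloisTypeProofs
import Literature.NumberTheory.GaloisRepresentations.LocalFieldFiniteExtension
import Literature.NumberTheory.GaloisRepresentations.LocalFieldPadicProofs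
import HarnessLib

/-!
# The MLF closure datum of the BASE FIELD `K ⊆ ℚ̄_p` of a tempered curve / [EtTh] theta setting, and the
# GENUINE `AbsTopMonoids` producer of [IUTchII] Ex 1.8 AT THE GENUINE SETTING `ThetaSetting.ofDoubleUnderline`

S. Mochizuki, *Inter-universal Teichmüller theory II*, §1, Example 1.8 (ii)–(iv) (kurims pp. 35–39): the
`Aut(Π)`-functorial monoids `O^⊳(Π) = 𝒪^⊳_{k̄}` with their `Π`-actions [claim: Mochizuki2012, status: disputed];
[AbsTopIII] Def 3.1 (i) p. 66 "Let `k` be an MLF, `k̄` an algebraic closure of `k`"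
[cite: MochizukiAbsTopIII2015, Definition 3.1 (i) p.66]; [SemiAnbd] §6 p. 69 "`G_K := Gal(K̄/K)`"
[cite: MochizukiSemiAnbd2006, §6 p.69].

STATE BEFORE THIS FILE.  abc-iut-L6-t13's GENUINE-mod-`ε` producer `AbsTopMonoids.genuineOfModel S C ε hΔ hq`
(`AbsTopMonoidsGenuineProducer.lean`, p421397) takes an abstract `MLFClosure C` and an identification
`ε : G_k^{(S)} ⥲ Gal(k̄/k)`; the tree's only `MLFClosure` instances are over `ℚ_p` itself
(`MLFClosure.ofPadic/padic/std`), so at the genuine [IUTchII] §1 setting `ThetaSetting.ofDoubleUnderline` of the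
Tate curve `X̲̲_K` (abc-iut-L6-d6 / L2-t8; `G_k = G_K = Gal(ℚ̄_p/K) ≤ G_{ℚ_p}` for the setting's OWN finite
extension `K/ℚ_p`) no `(C, ε)` was available.

THIS FILE supplies them (three definitions — post-freeze data, honest reading (ii) — and bookkeeping theorems):

* `MLFClosure.ofFinite p K` — for ANY finite extension `K` of `ℚ_p` (`[FiniteDimensional ℚ_[p] K]`): the datum
  `(k := K, k̄ := AlgebraicClosure K)` with `K`'s non-archimedean local field structure = the extended absolute
  value (abc-iut L4/S `FiniteExtension.valuativeRel/topologicalSpace/isNonarchimedeanLocalField`, Serre *Local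
  Fields* II §2, over `Padic.isNonarchimedeanLocalField_holds`); `isMLF_of_finite` (`IsMLF K`);
* `TemperedCurve.mlfClosure X` / `TemperedCurve.galoisEpsilon X` — for a tempered curve `X` over
  `K ⊆ ℚ̄_p` ([SemiAnbd] §6 interface): `C := MLFClosure.ofFinite p K` and the identification
  `ε : G_K = K.fixingSubgroup ⥲ Gal(K̄_K/K) = (ModelMLFGaloisData.galois C.k C.K).Pi` (abc-iut-L3's
  `fixingSubgroupContinuousMulEquiv`, the Galois identification of `TemperedCurve.galoisIdentification`);
* `AbsTopMonoids.genuineOfDoubleUnderline` — L6-t13's `genuineOfModel` INSTANTIATED at the genuine setting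
  `ofDoubleUnderline C μ hC hS hl hp2 hpl hζ hη` with the setting's own `(mlfClosure, galoisEpsilon)`, given (H1)
  `hΔ` and (H2) `hq`; `genuineOfDoubleUnderline_Otri` records that its monoid at every isomorph IS `𝒪^⊳_{K̄}` of
  THE SETTING'S FIELD (not a `ℚ_p` stand-in); `genuineOfDoubleUnderline_of_isOpenMap` takes (H2) from «`Π^tp_X →
  G_K` open» (abc-iut-L2-t11's `D`-indexed input; w5-d105's `quotDeltaX_iso_of_isOpenMap`).  (H1) at this setting is
  reduced to one [AbsTopI] Thm 2.6 (v) regime on a completion package by abc-iut-w5-d233's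
  `ThetaSettingDeltaCharacteristicGenuine.lean` (pending p429527) — kept a hypothesis here so this file does not
  depend on that module.

HONEST SCOPE: definitions + bookkeeping; the producer is L6-t13's (same term, `Ism` degenerate = B9 (d) residual);
no curve / theta setting is asserted to exist (interface data); nothing here bears on [IUTchIII] Cor. 3.12; no
side is taken; typed ≠ proved elsewhere.
-/

noncomputable section

/-! ### The MLF closure datum of a finite extension of `ℚ_p` -/

namespace Literature.AnabelianGeometry.AbsoluteAnabelian

open Literature.NumberTheory.GaloisRepresentations

/-- **`(k, k̄)` for a finite extension `K/ℚ_p`** ([AbsTopIII] Def 3.1 (i) "Let `k` be an MLF, `k̄` an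
algebraic closure of `k`"): `k := K` with the EXTENDED absolute value of `ℚ_p` (spectral norm; Serre, *Local
Fields* II §2 Prop. 3: a finite extension of a non-archimedean local field is one), `k̄ := AlgebraicClosure K`.
[cite: MochizukiAbsTopIII2015, Definition 3.1 (i) p.66] -/
def MLFClosure.ofFinite (p : ℕ) [Fact p.Prime] (K : Type) [Field K] [Algebra ℚ_[p] K]
    [FiniteDimensional ℚ_[p] K] : MLFClosure.{0} :=
  letI : IsNonarchimedeanLocalField ℚ_[p] := Padic.isNonarchimedeanLocalField_holds p
  letI := FiniteExtension.valuativeRel ℚ_[p] K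
  letI := FiniteExtension.topologicalSpace ℚ_[p] K
  haveI := FiniteExtension.isNonarchimedeanLocalField ℚ_[p] K
  haveI : CharZero K := charZero_of_injective_algebraMap (algebraMap ℚ_[p] K).injective
  { k := K, K := AlgebraicClosure K }

/-- The base field of `MLFClosure.ofFinite p K` is `K` (definitional bookkeeping).
[cite: MochizukiAbsTopIII2015, Definition 3.1 (i) p.66] -/
theorem MLFClosure.ofFinite_k (p : ℕ) [Fact p.Prime] (K : Type) [Field K] [Algebra ℚ_[p] K]
    [FiniteDimensional ℚ_[p] K] : (MLFClosure.ofFinite p K).k = K := rfl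

/-- The algebraic closure of `MLFClosure.ofFinite p K` is Mathlib's `AlgebraicClosure K` (definitional bookkeeping).
[cite: MochizukiAbsTopIII2015, Definition 3.1 (i) p.66] -/
theorem MLFClosure.ofFinite_K (p : ℕ) [Fact p.Prime] (K : Type) [Field K] [Algebra ℚ_[p] K]
    [FiniteDimensional ℚ_[p] K] : (MLFClosure.ofFinite p K).K = AlgebraicClosure K := rfl

/-- A finite extension of `ℚ_p` is an MLF in the sense of the [AbsTopI] §0 field-type predicate `IsMLF`
(`isMLF_padic` + `isMLF_of_finiteDimensional`). [cite: MochizukiAbsTopI2012, §0 p.7] -/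
theorem isMLF_of_finite (p : ℕ) [Fact p.Prime] (K : Type) [Field K] [Algebra ℚ_[p] K]
    [FiniteDimensional ℚ_[p] K] : IsMLF K :=
  Prop58ii.isMLF_of_finiteDimensional ℚ_[p] K (isMLF_padic p)

end Literature.AnabelianGeometry.AbsoluteAnabelian

/-! ### The MLF closure datum and the Galois identification of a tempered curve over `K ⊆ ℚ̄_p` -/

namespace Literature.AnabelianGeometry.SemiGraphs.TemperedCurve

open Literature.AnabelianGeometry.AbsoluteAnabelian

variable {p : ℕ} [Fact p.Prime]

/-- **`(K, K̄_K)` of a tempered curve** `X` over the finite extension `K ⊆ ℚ̄_p` of `ℚ_p` ([SemiAnbd] §6 p. 69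
"Let `K` be a finite extension of `ℚ_p`"): the MLF closure datum `MLFClosure.ofFinite p K`.
[cite: MochizukiSemiAnbd2006, §6 p.69] -/
def mlfClosure (X : TemperedCurve p) : MLFClosure.{0} :=
  @MLFClosure.ofFinite p _ X.K _ _ X.finiteDimensional_K

/-- **The Galois identification `ε : G_K ⥲ Gal(K̄_K/K)`** of a tempered curve, with target THE topological group
`(ModelMLFGaloisData.galois k k̄).Pi = (K̄_K ≃ₐ[K] K̄_K)` of the mono-analytic model data of `X.mlfClosure`
([AbsTopIII] Def 3.1 (ii) `ε_k = id`): abc-iut-L3's `fixingSubgroupContinuousMulEquiv K (algEquivAlgebraicClosure K)`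
("`G_K := Gal(K̄/K)`", canonical up to the choice of `K`-isomorphism `ℚ̄_p ≃ₐ[K] AlgebraicClosure K`).
[cite: MochizukiSemiAnbd2006, §6 p.69] -/
def galoisEpsilon (X : TemperedCurve p) :
    X.GK ≃ₜ* (ModelMLFGaloisData.galois X.mlfClosure.k X.mlfClosure.K).tmPair.Pi := by
  exact (Literature.FieldTheory.Galois.fixingSubgroupContinuousMulEquiv X.K
    (Literature.FieldTheory.Galois.algEquivAlgebraicClosure X.K) :)

/-- `ε` IS the Galois identification `TemperedCurve.galoisIdentification` of the interface, up to Mathlib's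
non-reducible wrapper `Field.absoluteGaloisGroup K = (K̄_K ≃ₐ[K] K̄_K)` (abc-iut-L3's identity isomorphism
`algEquivContinuousMulEquivAbsoluteGaloisGroup`). [cite: MochizukiSemiAnbd2006, §6 p.69] -/
theorem galoisEpsilon_eq_galoisIdentification_trans (X : TemperedCurve p) :
    X.galoisEpsilon = X.galoisIdentification.trans
      (Literature.FieldTheory.Galois.algEquivContinuousMulEquivAbsoluteGaloisGroup X.K).symm := by
  ext σ
  rfl

end Literature.AnabelianGeometry.SemiGraphs.TemperedCurve

/-! ### The genuine `AbsTopMonoids` producer AT THE GENUINE [IUTchII] §1 setting -/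

namespace Literature.IUT.HodgeArakelov

open Literature.AnabelianGeometry.AbsoluteAnabelian
open Literature.AnabelianGeometry.EtaleTheta Literature.AnabelianGeometry.SemiGraphs
open scoped Literature.AnabelianGeometry.EtaleTheta

namespace AbsTopMonoids

variable {p : ℕ} [Fact p.Prime] {D : Literature.AnabelianGeometry.EtaleTheta.ThetaSetting p}
  {ED : D.EtaleThetaData} {l : ℕ} (C : ED.DoubleUnderline l) {N : ℕ+} (μ : D.CyclotomeMod l N)
  (hC : D.Compat) (hS : D.Sec2Hyps) (hl : l.Prime) (hp2 : p ≠ 2) (hpl : p ≠ l)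
  (hζ : ∃ ζ : D.K, IsPrimitiveRoot ζ (4 * l)) {η : (C.thetaEnvData μ hC hS).PiYdd → MuN p N}
  (hη : η ∈ (C.thetaEnvData μ hC hS).thetaCocycles)

/-- **The GENUINE-mod-`ε` `AbsTopMonoids` AT THE GENUINE SETTING** of the Tate curve `X̲̲_K`: L6-t13's producer
`genuineOfModel` ([IUTchII] Ex 1.8 (ii)–(iv): `O^⊳(G) := 𝒪^⊳_{K̄}`, `G` acting through `θ`, morphisms lifted
through `Gal(K̄/K)`, `M_TM(Π) := O^⊳(Π/Δ)`) instantiated at `S = ofDoubleUnderline C μ hC hS hl hp2 hpl hζ hη`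
with the setting's OWN MLF closure datum `(K, AlgebraicClosure K)` and Galois identification `ε = galoisEpsilon`,
given (H1) `hΔ` and (H2) `hq`. [claim: Mochizuki2012, status: disputed] (IUTchII §1 Ex 1.8 (ii), kurims p.36) -/
def genuineOfDoubleUnderline
    (hΔ : ∀ f : (ThetaSetting.ofDoubleUnderline C μ hC hS hl hp2 hpl hζ hη).PiX ≃ₜ*
        (ThetaSetting.ofDoubleUnderline C μ hC hS hl hp2 hpl hζ hη).PiX,
      (ThetaSetting.ofDoubleUnderline C μ hC hS hl hp2 hpl hζ hη).DeltaX.map f.toMulEquiv.toMonoidHom =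
        (ThetaSetting.ofDoubleUnderline C μ hC hS hl hp2 hpl hζ hη).DeltaX)
    (hq : Nonempty (TopGroup.quot (ThetaSetting.ofDoubleUnderline C μ hC hS hl hp2 hpl hζ hη).PiX
        (ThetaSetting.ofDoubleUnderline C μ hC hS hl hp2 hpl hζ hη).DeltaX ≃ₜ*
        (ThetaSetting.ofDoubleUnderline C μ hC hS hl hp2 hpl hζ hη).Gk)) :
    AbsTopMonoids (ThetaSetting.ofDoubleUnderline C μ hC hS hl hp2 hpl hζ hη) :=
  genuineOfModel (ThetaSetting.ofDoubleUnderline C μ hC hS hl hp2 hpl hζ hη) D.toTemperedCurve.mlfClosure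
    D.toTemperedCurve.galoisEpsilon hΔ hq

/-- **Its monoid at every isomorph of `G_K` IS `𝒪^⊳_{K̄_K}`**, the multiplicative monoid of non-zero integers of
the algebraic closure of THE SETTING'S FIELD `K` (the model `TM`-pair of `MLFClosure.ofFinite p K`) — genuine,
not degenerate, not a `ℚ_p` stand-in. [claim: Mochizuki2012, status: disputed] (IUTchII §1 Ex 1.8 (ii), kurims p.36) -/
theorem genuineOfDoubleUnderline_Otri
    (hΔ : ∀ f : (ThetaSetting.ofDoubleUnderline C μ hC hS hl hp2 hpl hζ hη).PiX ≃ₜ*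
        (ThetaSetting.ofDoubleUnderline C μ hC hS hl hp2 hpl hζ hη).PiX,
      (ThetaSetting.ofDoubleUnderline C μ hC hS hl hp2 hpl hζ hη).DeltaX.map f.toMulEquiv.toMonoidHom =
        (ThetaSetting.ofDoubleUnderline C μ hC hS hl hp2 hpl hζ hη).DeltaX)
    (hq : Nonempty (TopGroup.quot (ThetaSetting.ofDoubleUnderline C μ hC hS hl hp2 hpl hζ hη).PiX
        (ThetaSetting.ofDoubleUnderline C μ hC hS hl hp2 hpl hζ hη).DeltaX ≃ₜ*
        (ThetaSetting.ofDoubleUnderline C μ hC hS hl hp2 hpl hζ hη).Gk))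
    (G : IsoClass (ThetaSetting.ofDoubleUnderline C μ hC hS hl hp2 hpl hζ hη).Gk) :
    (genuineOfDoubleUnderline C μ hC hS hl hp2 hpl hζ hη hΔ hq).Otri G =
      (ModelMLFGaloisData.galois D.toTemperedCurve.mlfClosure.k D.toTemperedCurve.mlfClosure.K).tmPair.M := rfl

/-- **The genuine producer with (H2) taken from «`Π^tp_X → G_K` is open»** (abc-iut-L2-t11's `D`-indexed
genuine-models-only input): the augmentation of `ofDoubleUnderline` is then open (restriction to the open
`Π^tp_{X̲̲}`), so `Π^{(S)}/Δ^{(S)} ≅ G_K` topologically (w5-d105's `quotDeltaX_iso_of_isOpenMap`); only (H1) is left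
as a hypothesis. [claim: Mochizuki2012, status: disputed] (IUTchII §1 Ex 1.8 (ii), kurims p.36) -/
def genuineOfDoubleUnderline_of_isOpenMap
    (hopen : IsOpenMap fun x : D.PiTemp => (⟨D.aug x, D.aug_mem_GK x⟩ : D.GK))
    (hΔ : ∀ f : (ThetaSetting.ofDoubleUnderline C μ hC hS hl hp2 hpl hζ hη).PiX ≃ₜ*
        (ThetaSetting.ofDoubleUnderline C μ hC hS hl hp2 hpl hζ hη).PiX,
      (ThetaSetting.ofDoubleUnderline C μ hC hS hl hp2 hpl hζ hη).DeltaX.map f.toMulEquiv.toMonoidHom =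
        (ThetaSetting.ofDoubleUnderline C μ hC hS hl hp2 hpl hζ hη).DeltaX) :
    AbsTopMonoids (ThetaSetting.ofDoubleUnderline C μ hC hS hl hp2 hpl hζ hη) :=
  genuineOfDoubleUnderline C μ hC hS hl hp2 hpl hζ hη hΔ
    (quotDeltaX_iso_of_isOpenMap _ (hopen.comp C.isOpen_Huu.isOpenMap_subtype_val))

/-- In particular the interface is inhabited at the genuine setting by a GENUINE-mod-`ε` producer under
«aug open» + (H1). [claim: Mochizuki2012, status: disputed] (IUTchII §1 Ex 1.8 (ii), kurims p.36) -/
theorem nonempty_genuine_ofDoubleUnderline_of_isOpenMap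
    (hopen : IsOpenMap fun x : D.PiTemp => (⟨D.aug x, D.aug_mem_GK x⟩ : D.GK))
    (hΔ : ∀ f : (ThetaSetting.ofDoubleUnderline C μ hC hS hl hp2 hpl hζ hη).PiX ≃ₜ*
        (ThetaSetting.ofDoubleUnderline C μ hC hS hl hp2 hpl hζ hη).PiX,
      (ThetaSetting.ofDoubleUnderline C μ hC hS hl hp2 hpl hζ hη).DeltaX.map f.toMulEquiv.toMonoidHom =
        (ThetaSetting.ofDoubleUnderline C μ hC hS hl hp2 hpl hζ hη).DeltaX) :
    ∃ A : AbsTopMonoids (ThetaSetting.ofDoubleUnderline C μ hC hS hl hp2 hpl hζ hη),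
      ∀ G, A.Otri G =
        (ModelMLFGaloisData.galois D.toTemperedCurve.mlfClosure.k D.toTemperedCurve.mlfClosure.K).tmPair.M :=
  ⟨genuineOfDoubleUnderline_of_isOpenMap C μ hC hS hl hp2 hpl hζ hη hopen hΔ, fun _ => rfl⟩

end AbsTopMonoids

end Literature.IUT.HodgeArakelov

end
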